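import Summits.CriticalPhenomena.PercolationContinuityZ3.Theorems.PercNearOneGluingNoHeavyLowerTailSahiCTCC2ThreeRowThreePrep
import HarnessLib

/-!
# `NoHeavyLowerTail` (crux stmt-CriticalPhenomena-4575), P3 lane: row 3 of the level-3 monotonicity C2, part 2 — at a profile with exactly three
# doubled points and entries `≤ 2` the C2 difference of `R_3` dominates the FOUR-POINT FUNCTIONAL of `Q = dbl + v`

Support file (seat `prim-l12-p3`, gen 43; `--supports stmt-CriticalPhenomena-4575`).  Memo
`run/shared/lean/prim/prim-l12/FROM-prim-l12-p3-g43-C2-LEVEL-THREE.md` §4.  **`fourPoint_le_coeff_C2three`**: for up-sets `𝒳, 𝒵`, a vertex `v` and a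
`v`-free profile `m ≤ 2` with `dbl m = {d₁,d₂,d₃}`, the coefficient `[s^m](P₂ − P₃)` of the C2 difference of `R_3` at `v` is at least
    `κ(Q₀,{v}) + Σ_d κ(Q₀−d,{v,d}) + Σ_d κ({v,d},Q₀−d) + Σ_y([Q₀−y ∈ 𝒳][yv ∈ 𝒵] + [yv ∈ 𝒳][Q₀−y ∈ 𝒵]) − #{common 2-subsets of Q}`
(`Q₀ = {d₁,d₂,d₃}`), i.e. the functional of `…SahiCTCC2ThreeFourPoint.fourPoint_nonneg` — by the `v`-free Harris form (`…SahiCTCC2ThreeForm`),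
keeping from the two Harris blocks only the small sets inside `Q₀` and shrinking every free set to its points in `Q` (`…RowThreePrep.kap_mono_free`),
keeping from the cross block only the term `T = supp m` of `Π'`, and bounding the subtracted block by the common 2-subsets of `Q`
(`…RowThreePrep.coeff_Pi_delV_mul_le / coeff_Pi_linkV_mul_le`).  With `fourPoint_nonneg` this is row 3 (every number of single points) of C2 at
level 3 (the assembly is a separate file, once `…C2ThreeFourPoint` has landed).  Nothing is asserted about the crux.
-/

noncomputable section

open scoped Classical

namespace Summit.CriticalPhenomena.PercolationContinuityZ3.Theorems.SahiCTCForms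

open Finset MvPolynomial SahiCTCGenFun

variable {α : Type*} [DecidableEq α] [Fintype α]

/-! ### Small counting helpers -/

omit [Fintype α] in
/-- The card of the filter of a 3-set as three indicators. [this work] -/
theorem card_filter_three {β : Type*} [DecidableEq β] {e₁ e₂ e₃ : β} (h12 : e₁ ≠ e₂) (h13 : e₁ ≠ e₃) (h23 : e₂ ≠ e₃)
    (P : β → Prop) [DecidablePred P] :
    (#(({e₁, e₂, e₃} : Finset β).filter P) : ℤ) = (if P e₁ then (1 : ℤ) else 0) + (if P e₂ then 1 else 0) + (if P e₃ then 1 else 0) := by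
  rw [card_filter, sum_insert (by simp [h12, h13]), sum_insert (by simp [h23]), sum_singleton]
  push_cast [Nat.cast_ite]
  ring

omit [Fintype α] in
/-- Three conditional units inside a finset: if `P_i → e_i ∈ X` for three distinct `e_i`, then `[P₁] + [P₂] + [P₃] ≤ #X`. [this work] -/
theorem ite_add_ite_add_ite_le_card {β : Type*} [DecidableEq β] (X : Finset β) {e₁ e₂ e₃ : β} (h12 : e₁ ≠ e₂) (h13 : e₁ ≠ e₃) (h23 : e₂ ≠ e₃)
    {P₁ P₂ P₃ : Prop} [Decidable P₁] [Decidable P₂] [Decidable P₃] (h₁ : P₁ → e₁ ∈ X) (h₂ : P₂ → e₂ ∈ X) (h₃ : P₃ → e₃ ∈ X) :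
    (if P₁ then (1 : ℤ) else 0) + (if P₂ then (1 : ℤ) else 0) + (if P₃ then (1 : ℤ) else 0) ≤ #X := by
  have hsub : (({e₁, e₂, e₃} : Finset β).filter fun e => e ∈ X) ⊆ X := fun e he => (mem_filter.1 he).2
  have hc : (#(({e₁, e₂, e₃} : Finset β).filter fun e => e ∈ X) : ℤ) ≤ #X := by exact_mod_cast card_le_card hsub
  rw [card_filter_three h12 h13 h23] at hc
  have i1 : (if P₁ then (1 : ℤ) else 0) ≤ if e₁ ∈ X then 1 else 0 := by
    by_cases hp : P₁
    · rw [if_pos hp, if_pos (h₁ hp)]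
    · rw [if_neg hp]; split_ifs <;> norm_num
  have i2 : (if P₂ then (1 : ℤ) else 0) ≤ if e₂ ∈ X then 1 else 0 := by
    by_cases hp : P₂
    · rw [if_pos hp, if_pos (h₂ hp)]
    · rw [if_neg hp]; split_ifs <;> norm_num
  have i3 : (if P₃ then (1 : ℤ) else 0) ≤ if e₃ ∈ X then 1 else 0 := by
    by_cases hp : P₃
    · rw [if_pos hp, if_pos (h₃ hp)]
    · rw [if_neg hp]; split_ifs <;> norm_num
  linarith

/-! ### The lower bound -/

section RowThree
variable {F G : Finset (Finset α)} {v d₁ d₂ d₃ : α} {m : α →₀ ℕ}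

/-- **ROW 3 OF C2 AT LEVEL 3, LOWER BOUND BY THE FOUR-POINT FUNCTIONAL.**  For up-sets `𝒳, 𝒵`, a vertex `v` and a `v`-free profile `m ≤ 2` whose
doubled set is `{d₁,d₂,d₃}` (three distinct points), the coefficient at `m` of the C2 difference `P₂ − P₃` of `R_3` at `v` is at least the four-point
functional of `…SahiCTCC2ThreeFourPoint` (all single points dropped). [this work] -/
theorem fourPoint_le_coeff_C2three (hF : IsUpperSet (F : Set (Finset α))) (hG : IsUpperSet (G : Set (Finset α)))
    (hv : m v = 0) (h2 : ∀ i, m i ≤ 2) (hdbl : dbl m = {d₁, d₂, d₃}) (h12 : d₁ ≠ d₂) (h13 : d₁ ≠ d₃) (h23 : d₂ ≠ d₃) :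
    kap F G {d₁, d₂, d₃} {v}
      + (kap F G {d₂, d₃} {v, d₁} + kap F G {d₁, d₃} {v, d₂} + kap F G {d₁, d₂} {v, d₃})
      + (kap F G {v, d₁} {d₂, d₃} + kap F G {v, d₂} {d₁, d₃} + kap F G {v, d₃} {d₁, d₂})
      + ((if ({d₂, d₃} : Finset α) ∈ F ∧ ({v, d₁} : Finset α) ∈ G then (1 : ℤ) else 0)
        + (if ({v, d₁} : Finset α) ∈ F ∧ ({d₂, d₃} : Finset α) ∈ G then (1 : ℤ) else 0)
        + (if ({d₁, d₃} : Finset α) ∈ F ∧ ({v, d₂} : Finset α) ∈ G then (1 : ℤ) else 0)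
        + (if ({v, d₂} : Finset α) ∈ F ∧ ({d₁, d₃} : Finset α) ∈ G then (1 : ℤ) else 0)
        + (if ({d₁, d₂} : Finset α) ∈ F ∧ ({v, d₃} : Finset α) ∈ G then (1 : ℤ) else 0)
        + (if ({v, d₃} : Finset α) ∈ F ∧ ({d₁, d₂} : Finset α) ∈ G then (1 : ℤ) else 0))
      - ((if ({d₁, d₂} : Finset α) ∈ F ∧ ({d₁, d₂} : Finset α) ∈ G then (1 : ℤ) else 0)
        + (if ({d₁, d₃} : Finset α) ∈ F ∧ ({d₁, d₃} : Finset α) ∈ G then (1 : ℤ) else 0)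
        + (if ({d₂, d₃} : Finset α) ∈ F ∧ ({d₂, d₃} : Finset α) ∈ G then (1 : ℤ) else 0)
        + (if ({v, d₁} : Finset α) ∈ F ∧ ({v, d₁} : Finset α) ∈ G then (1 : ℤ) else 0)
        + (if ({v, d₂} : Finset α) ∈ F ∧ ({v, d₂} : Finset α) ∈ G then (1 : ℤ) else 0)
        + (if ({v, d₃} : Finset α) ∈ F ∧ ({v, d₃} : Finset α) ∈ G then (1 : ℤ) else 0))
      ≤ (RlumpVx (bySize (· < 3)) F G v 2 - RlumpVx (bySize (· < 3)) F G v 3).coeff m := by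
  -- ===== bookkeeping facts about the four points =====
  have hd1 : m d₁ = 2 := mem_dbl_iff.1 (by rw [hdbl]; simp)
  have hd2 : m d₂ = 2 := mem_dbl_iff.1 (by rw [hdbl]; simp)
  have hd3 : m d₃ = 2 := mem_dbl_iff.1 (by rw [hdbl]; simp)
  have hv1 : v ≠ d₁ := fun h => by rw [h] at hv; omega
  have hv2 : v ≠ d₂ := fun h => by rw [h] at hv; omega
  have hv3 : v ≠ d₃ := fun h => by rw [h] at hv; omega
  have hvdbl : v ∉ dbl m := fun h => by have := mem_dbl_iff.1 h; omega
  have hvsgl : v ∉ sgl m := fun h => by have := (mem_sgl_iff_of_le_two h2).1 h; omega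
  have hcard : #(dbl m) = 3 := by rw [hdbl, card_insert_of_notMem (by simp [h12, h13]), card_pair h23]
  have hds : Disjoint (dbl m) (sgl m) := disjoint_dbl_sgl m
  -- erasing one point / removing a pair from `{d₁,d₂,d₃}`
  have er1 : ({d₁, d₂, d₃} : Finset α).erase d₁ = {d₂, d₃} := erase_insert (by simp [h12, h13])
  have er2 : ({d₁, d₂, d₃} : Finset α).erase d₂ = {d₁, d₃} := by
    rw [erase_insert_of_ne h12, erase_insert (by simp [h23])]
  have er3 : ({d₁, d₂, d₃} : Finset α).erase d₃ = {d₁, d₂} := by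
    rw [erase_insert_of_ne h13, erase_insert_of_ne h23, erase_singleton, insert_empty]
  have sd1 : ({d₁, d₂, d₃} : Finset α) \ {d₂, d₃} = {d₁} := by
    ext x; simp only [mem_sdiff, mem_insert, mem_singleton]
    constructor
    · rintro ⟨h | h | h, hn⟩; exact h; exact absurd (Or.inl h) hn; exact absurd (Or.inr h) hn
    · rintro rfl; exact ⟨Or.inl rfl, fun h => h.elim h12 h13⟩
  have sd2 : ({d₁, d₂, d₃} : Finset α) \ {d₁, d₃} = {d₂} := by
    ext x; simp only [mem_sdiff, mem_insert, mem_singleton]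
    constructor
    · rintro ⟨h | h | h, hn⟩; exact absurd (Or.inl h) hn; exact h; exact absurd (Or.inr h) hn
    · rintro rfl; exact ⟨Or.inr (Or.inl rfl), fun h => h.elim (Ne.symm h12) h23⟩
  have sd3 : ({d₁, d₂, d₃} : Finset α) \ {d₁, d₂} = {d₃} := by
    ext x; simp only [mem_sdiff, mem_insert, mem_singleton]
    constructor
    · rintro ⟨h | h | h, hn⟩; exact absurd (Or.inl h) hn; exact absurd (Or.inr h) hn; exact h
    · rintro rfl; exact ⟨Or.inr (Or.inr rfl), fun h => h.elim (Ne.symm h13) (Ne.symm h23)⟩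
  -- the expansion
  rw [RlumpVx_two_sub_three_eq_vfree, coeff_sub, coeff_add, coeff_add]
  set D : Finset (Finset α) := bySize (· < 3) with hD
  set Pi' : MvPolynomial α ℤ := gf (delV v (univ.powerset : Finset (Finset α))) with hPi'
  set H1 : MvPolynomial α ℤ := (gf (delV v (univ.powerset : Finset (Finset α))) * gf (delV v F ∩ delV v G) - gf (delV v F) * gf (delV v G))
      + (gf (delV v (univ.powerset : Finset (Finset α))) * gf (linkV v F ∩ linkV v G) - gf (linkV v F) * gf (linkV v G))
      + (gf (linkV v F) - gf (delV v F)) * (gf (linkV v G) - gf (delV v G)) with hH1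
  set HL : MvPolynomial α ℤ := gf (delV v (univ.powerset : Finset (Finset α))) * gf (linkV v F ∩ linkV v G) - gf (linkV v F) * gf (linkV v G)
    with hHL
  have hH1nn : ∀ n, 0 ≤ H1.coeff n := coeff_harrisVfree_nonneg hF hG
  have hHLnn : ∀ n, 0 ≤ HL.coeff n := coeff_harrisLink_nonneg hF hG
  -- residual profiles
  have hres : ∀ b : Finset α, (∀ i, (m - ind b) i ≤ 2) ∧ (m - ind b) v = 0 := fun b =>
    ⟨fun i => by rw [Finsupp.tsub_apply]; exact le_trans (Nat.sub_le _ _) (h2 i), by rw [Finsupp.tsub_apply, hv]; omega⟩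
  -- ===== (A) the block GF(D¹)·H₁ =====
  have hA : kap F G {d₁, d₂, d₃} {v} + (kap F G {d₂, d₃} {v, d₁} + kap F G {d₁, d₃} {v, d₂} + kap F G {d₁, d₂} {v, d₃})
      ≤ (gf (linkV v D) * H1).coeff m := by
    rw [coeff_gf_mul]
    have hsub : ({∅, {d₁}, {d₂}, {d₃}} : Finset (Finset α)) ⊆ (linkV v D).filter fun b => ind b ≤ m := by
      intro b hb
      simp only [mem_insert, mem_singleton] at hb
      rw [mem_filter]
      rcases hb with rfl | rfl | rfl | rfl
      · exact ⟨mem_linkV_bySize_of_card (notMem_empty v) (by simp), by intro i; rw [ind_apply]; simp⟩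
      · refine ⟨mem_linkV_bySize_of_card (by simpa using hv1) (by simp), fun i => ?_⟩
        rw [ind_apply]; split_ifs with h
        · rw [mem_singleton.1 h]; omega
        · omega
      · refine ⟨mem_linkV_bySize_of_card (by simpa using hv2) (by simp), fun i => ?_⟩
        rw [ind_apply]; split_ifs with h
        · rw [mem_singleton.1 h]; omega
        · omega
      · refine ⟨mem_linkV_bySize_of_card (by simpa using hv3) (by simp), fun i => ?_⟩
        rw [ind_apply]; split_ifs with h
        · rw [mem_singleton.1 h]; omega
        · omega
    refine le_trans ?_ (sum_le_sum_of_subset_of_nonneg hsub fun b _ _ => hH1nn _)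
    have n1 : (∅ : Finset α) ∉ ({{d₁}, {d₂}, {d₃}} : Finset (Finset α)) := by simp
    have n2 : ({d₁} : Finset α) ∉ ({{d₂}, {d₃}} : Finset (Finset α)) := by
      simp only [mem_insert, mem_singleton, singleton_inj, not_or]; exact ⟨h12, h13⟩
    have n3 : ({d₂} : Finset α) ≠ {d₃} := fun h => h23 (singleton_inj.1 h)
    rw [sum_insert n1, sum_insert n2, sum_pair n3]
    -- b = ∅
    have t0 : kap F G {d₁, d₂, d₃} {v} ≤ H1.coeff (m - ind (∅ : Finset α)) := by
      have : ind (∅ : Finset α) = 0 := by unfold ind; rw [sum_empty]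
      rw [this, tsub_zero, hH1, coeff_harrisVfree_eq_kap hF hG h2 hv, hdbl]
      refine kap_mono_free hF hG ?_ (by simp)
      rw [← hdbl]; exact disjoint_insert_right.2 ⟨hvdbl, hds⟩
    -- b = {d}
    have td : ∀ {d : α}, m d = 2 → v ≠ d → kap F G ((dbl m).erase d) {v, d} ≤ H1.coeff (m - ind ({d} : Finset α)) := by
      intro d hd hvd
      rw [hH1, coeff_harrisVfree_eq_kap hF hG (hres {d}).1 (hres {d}).2, dbl_tsub_ind_singleton hd, sgl_tsub_ind_singleton h2 hd]
      refine kap_mono_free hF hG ?_ (insert_subset_insert v (by simp))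
      rw [disjoint_insert_right, disjoint_insert_right]
      exact ⟨fun h => hvdbl (mem_of_mem_erase h), notMem_erase d _, (hds.mono_left (erase_subset d _))⟩
    have t1 := td hd1 hv1; have t2 := td hd2 hv2; have t3 := td hd3 hv3
    rw [hdbl, er1] at t1; rw [hdbl, er2] at t2; rw [hdbl, er3] at t3
    linarith
  -- ===== (B) the block GF(D⁰∖D¹)·H_L =====
  have hB : kap F G {v, d₁} {d₂, d₃} + kap F G {v, d₂} {d₁, d₃} + kap F G {v, d₃} {d₁, d₂}
      ≤ ((gf (delV v D) - gf (linkV v D)) * HL).coeff m := by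
    rw [gf_sub_gf_eq_gf_sdiff (linkV_subset_delV_of_isLowerSet (isLowerSet_bySize_lt 3)), coeff_gf_mul]
    have hsub : ({{d₂, d₃}, {d₁, d₃}, {d₁, d₂}} : Finset (Finset α)) ⊆ (delV v D \ linkV v D).filter fun a => ind a ≤ m := by
      intro a ha
      simp only [mem_insert, mem_singleton] at ha
      rw [mem_filter]
      have key : ∀ {x y : α}, x ≠ y → v ≠ x → v ≠ y → m x = 2 → m y = 2 →
          ({x, y} : Finset α) ∈ delV v D \ linkV v D ∧ ind ({x, y} : Finset α) ≤ m := by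
        intro x y hxy hvx hvy hx hy
        refine ⟨mem_delV_sdiff_linkV_of_card_two (by simp [hvx, hvy]) (card_pair hxy), fun i => ?_⟩
        rw [ind_apply]; split_ifs with h
        · simp only [mem_insert, mem_singleton] at h; rcases h with rfl | rfl <;> omega
        · omega
      rcases ha with rfl | rfl | rfl
      · exact key h23 hv2 hv3 hd2 hd3
      · exact key h13 hv1 hv3 hd1 hd3
      · exact key h12 hv1 hv2 hd1 hd2
    refine le_trans ?_ (sum_le_sum_of_subset_of_nonneg hsub fun a _ _ => hHLnn _)
    have n1 : ({d₂, d₃} : Finset α) ∉ ({{d₁, d₃}, {d₁, d₂}} : Finset (Finset α)) := by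
      simp only [mem_insert, mem_singleton, not_or]
      refine ⟨fun h => ?_, fun h => ?_⟩
      · have : d₂ ∈ ({d₁, d₃} : Finset α) := by rw [← h]; simp
        simp only [mem_insert, mem_singleton] at this; exact this.elim (Ne.symm h12) h23
      · have : d₃ ∈ ({d₁, d₂} : Finset α) := by rw [← h]; simp
        simp only [mem_insert, mem_singleton] at this; exact this.elim (Ne.symm h13) (Ne.symm h23)
    have n2 : ({d₁, d₃} : Finset α) ≠ {d₁, d₂} := fun h => by
      have : d₃ ∈ ({d₁, d₂} : Finset α) := by rw [← h]; simp
      simp only [mem_insert, mem_singleton] at this; exact this.elim (Ne.symm h13) (Ne.symm h23)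
    rw [sum_insert n1, sum_pair n2]
    have ta : ∀ {a : Finset α}, a ⊆ dbl m → v ∉ a → kap F G (insert v (dbl m \ a)) a ≤ HL.coeff (m - ind a) := by
      intro a ha hva
      rw [hHL, coeff_harrisLink_eq_kap F G (hres a).1 (hres a).2, dbl_tsub_ind_of_subset_dbl ha, sgl_tsub_ind_of_subset_dbl h2 ha]
      refine kap_mono_free hF hG ?_ subset_union_right
      rw [disjoint_insert_left, mem_union, not_or]
      exact ⟨⟨hvsgl, hva⟩, disjoint_union_right.2 ⟨hds.mono_left sdiff_subset, disjoint_sdiff_self_left⟩⟩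
    have t1 := ta (a := {d₂, d₃}) (by rw [hdbl]; intro x; simp only [mem_insert, mem_singleton]; tauto) (by simp [hv2, hv3])
    have t2 := ta (a := {d₁, d₃}) (by rw [hdbl]; intro x; simp only [mem_insert, mem_singleton]; tauto) (by simp [hv1, hv3])
    have t3 := ta (a := {d₁, d₂}) (by rw [hdbl]; intro x; simp only [mem_insert, mem_singleton]; tauto) (by simp [hv1, hv2])
    rw [hdbl, sd1] at t1; rw [hdbl, sd2] at t2; rw [hdbl, sd3] at t3
    linarith
  -- ===== (C) the cross block =====
  have hC : (if ({d₂, d₃} : Finset α) ∈ F ∧ ({v, d₁} : Finset α) ∈ G then (1 : ℤ) else 0)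
        + (if ({v, d₁} : Finset α) ∈ F ∧ ({d₂, d₃} : Finset α) ∈ G then (1 : ℤ) else 0)
        + (if ({d₁, d₃} : Finset α) ∈ F ∧ ({v, d₂} : Finset α) ∈ G then (1 : ℤ) else 0)
        + (if ({v, d₂} : Finset α) ∈ F ∧ ({d₁, d₃} : Finset α) ∈ G then (1 : ℤ) else 0)
        + (if ({d₁, d₂} : Finset α) ∈ F ∧ ({v, d₃} : Finset α) ∈ G then (1 : ℤ) else 0)
        + (if ({v, d₃} : Finset α) ∈ F ∧ ({d₁, d₂} : Finset α) ∈ G then (1 : ℤ) else 0)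
      ≤ (Pi' * (gf (delV v (F.filter fun S => S ∈ D)) * gf (linkV v (G.filter fun S => S ∈ D))
          + gf (linkV v (F.filter fun S => S ∈ D)) * gf (delV v (G.filter fun S => S ∈ D)))).coeff m := by
    set CR := gf (delV v (F.filter fun S => S ∈ D)) * gf (linkV v (G.filter fun S => S ∈ D))
          + gf (linkV v (F.filter fun S => S ∈ D)) * gf (delV v (G.filter fun S => S ∈ D)) with hCR
    have hCRnn : ∀ n, 0 ≤ CR.coeff n := fun n => by
      rw [hCR, coeff_add]
      exact add_nonneg (coeff_mul_nonneg (coeff_gf_nonneg _) (coeff_gf_nonneg _) n)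
        (coeff_mul_nonneg (coeff_gf_nonneg _) (coeff_gf_nonneg _) n)
    rw [hPi', coeff_gf_mul]
    have hT : m.support ∈ (delV v (univ.powerset : Finset (Finset α))).filter fun T => ind T ≤ m :=
      mem_filter.2 ⟨mem_filter.2 ⟨mem_powerset.2 (subset_univ _), by rw [Finsupp.mem_support_iff, not_not]; exact hv⟩, ind_support_le m⟩
    refine le_trans ?_ (single_le_sum (fun T _ => hCRnn _) hT)
    rw [tsub_ind_support_eq_ind_dbl h2, hdbl, hCR, coeff_add, coeff_gf_mul_gf, coeff_gf_mul_gf]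
    -- the three crossed pairs on each side
    have memA : ∀ {x y : α}, x ≠ y → v ≠ x → v ≠ y → ∀ {K : Finset (Finset α)},
        (({x, y} : Finset α) ∈ delV v (K.filter fun S => S ∈ D) ↔ ({x, y} : Finset α) ∈ K) :=
      fun hxy hvx hvy => mem_delV_filter_bySize_iff (by simp [hvx, hvy]) (by rw [card_pair hxy])
    have memB : ∀ {y : α}, v ≠ y → ∀ {K : Finset (Finset α)},
        (({y} : Finset α) ∈ linkV v (K.filter fun S => S ∈ D) ↔ ({v, y} : Finset α) ∈ K) :=
      fun hvy => mem_linkV_filter_bySize_iff (by simpa using hvy) (by simp)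
    have indeq : ∀ {x y z : α}, x ∉ ({y, z} : Finset α) → insert x ({y, z} : Finset α) = {d₁, d₂, d₃} →
        ind ({y, z} : Finset α) + ind ({x} : Finset α) = ind ({d₁, d₂, d₃} : Finset α) := by
      intro x y z hx he
      rw [← he, ind_insert hx, add_comm]
      congr 1
      unfold ind; rw [sum_singleton]
    have s2a : insert d₂ ({d₁, d₃} : Finset α) = {d₁, d₂, d₃} := by ext x; simp only [mem_insert, mem_singleton]; tauto
    have s3a : insert d₃ ({d₁, d₂} : Finset α) = {d₁, d₂, d₃} := by ext x; simp only [mem_insert, mem_singleton]; tauto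
    have i1 := indeq (x := d₁) (y := d₂) (z := d₃) (by simp [h12, h13]) rfl
    have i2 := indeq (x := d₂) (y := d₁) (z := d₃) (by simp [Ne.symm h12, h23]) s2a
    have i3 := indeq (x := d₃) (y := d₁) (z := d₂) (by simp [Ne.symm h13, Ne.symm h23]) s3a
    have ne12 : ((({d₂, d₃} : Finset α), ({d₁} : Finset α)) : Finset α × Finset α) ≠ ({d₁, d₃}, {d₂}) :=
      fun h => h12 (singleton_inj.1 (Prod.ext_iff.1 h).2)
    have ne13 : ((({d₂, d₃} : Finset α), ({d₁} : Finset α)) : Finset α × Finset α) ≠ ({d₁, d₂}, {d₃}) :=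
      fun h => h13 (singleton_inj.1 (Prod.ext_iff.1 h).2)
    have ne23 : ((({d₁, d₃} : Finset α), ({d₂} : Finset α)) : Finset α × Finset α) ≠ ({d₁, d₂}, {d₃}) :=
      fun h => h23 (singleton_inj.1 (Prod.ext_iff.1 h).2)
    have lhs1 := ite_add_ite_add_ite_le_card
      (((delV v (F.filter fun S => S ∈ D)) ×ˢ (linkV v (G.filter fun S => S ∈ D))).filter
        fun PS => ind PS.1 + ind PS.2 = ind ({d₁, d₂, d₃} : Finset α))
      ne12 ne13 ne23
      (P₁ := ({d₂, d₃} : Finset α) ∈ F ∧ ({v, d₁} : Finset α) ∈ G)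
      (P₂ := ({d₁, d₃} : Finset α) ∈ F ∧ ({v, d₂} : Finset α) ∈ G)
      (P₃ := ({d₁, d₂} : Finset α) ∈ F ∧ ({v, d₃} : Finset α) ∈ G)
      (fun h => mem_filter.2 ⟨mem_product.2 ⟨(memA h23 hv2 hv3).2 h.1, (memB hv1).2 h.2⟩, i1⟩)
      (fun h => mem_filter.2 ⟨mem_product.2 ⟨(memA h13 hv1 hv3).2 h.1, (memB hv2).2 h.2⟩, i2⟩)
      (fun h => mem_filter.2 ⟨mem_product.2 ⟨(memA h12 hv1 hv2).2 h.1, (memB hv3).2 h.2⟩, i3⟩)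
    have ne12' : ((({d₁} : Finset α), ({d₂, d₃} : Finset α)) : Finset α × Finset α) ≠ ({d₂}, {d₁, d₃}) :=
      fun h => h12 (singleton_inj.1 (Prod.ext_iff.1 h).1)
    have ne13' : ((({d₁} : Finset α), ({d₂, d₃} : Finset α)) : Finset α × Finset α) ≠ ({d₃}, {d₁, d₂}) :=
      fun h => h13 (singleton_inj.1 (Prod.ext_iff.1 h).1)
    have ne23' : ((({d₂} : Finset α), ({d₁, d₃} : Finset α)) : Finset α × Finset α) ≠ ({d₃}, {d₁, d₂}) :=
      fun h => h23 (singleton_inj.1 (Prod.ext_iff.1 h).1)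
    have lhs2 := ite_add_ite_add_ite_le_card
      (((linkV v (F.filter fun S => S ∈ D)) ×ˢ (delV v (G.filter fun S => S ∈ D))).filter
        fun PS => ind PS.1 + ind PS.2 = ind ({d₁, d₂, d₃} : Finset α))
      ne12' ne13' ne23'
      (P₁ := ({v, d₁} : Finset α) ∈ F ∧ ({d₂, d₃} : Finset α) ∈ G)
      (P₂ := ({v, d₂} : Finset α) ∈ F ∧ ({d₁, d₃} : Finset α) ∈ G)
      (P₃ := ({v, d₃} : Finset α) ∈ F ∧ ({d₁, d₂} : Finset α) ∈ G)
      (fun h => mem_filter.2 ⟨mem_product.2 ⟨(memB hv1).2 h.1, (memA h23 hv2 hv3).2 h.2⟩, by rw [add_comm]; exact i1⟩)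
      (fun h => mem_filter.2 ⟨mem_product.2 ⟨(memB hv2).2 h.1, (memA h13 hv1 hv3).2 h.2⟩, by rw [add_comm]; exact i2⟩)
      (fun h => mem_filter.2 ⟨mem_product.2 ⟨(memB hv3).2 h.1, (memA h12 hv1 hv2).2 h.2⟩, by rw [add_comm]; exact i3⟩)
    linarith
  -- ===== (D) the subtracted block =====
  have hDle : (Pi' * (gf (delV v D) * gf (linkV v ((F ∩ G).filter fun S => S ∈ D))
        + gf (linkV v D) * gf (delV v ((F ∩ G).filter fun S => S ∈ D)))).coeff m
      ≤ ((if ({d₁, d₂} : Finset α) ∈ F ∧ ({d₁, d₂} : Finset α) ∈ G then (1 : ℤ) else 0)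
        + (if ({d₁, d₃} : Finset α) ∈ F ∧ ({d₁, d₃} : Finset α) ∈ G then (1 : ℤ) else 0)
        + (if ({d₂, d₃} : Finset α) ∈ F ∧ ({d₂, d₃} : Finset α) ∈ G then (1 : ℤ) else 0)
        + (if ({v, d₁} : Finset α) ∈ F ∧ ({v, d₁} : Finset α) ∈ G then (1 : ℤ) else 0)
        + (if ({v, d₂} : Finset α) ∈ F ∧ ({v, d₂} : Finset α) ∈ G then (1 : ℤ) else 0)
        + (if ({v, d₃} : Finset α) ∈ F ∧ ({v, d₃} : Finset α) ∈ G then (1 : ℤ) else 0)) := by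
    rw [mul_add, coeff_add, hPi', hD]
    have b1 := coeff_Pi_delV_mul_le (W' := linkV v ((F ∩ G).filter fun S => S ∈ (bySize (· < 3) : Finset (Finset α))))
      (fun b hb => card_le_one_of_mem_linkV_filter hb) hv h2 hcard
    have b2 := coeff_Pi_linkV_mul_le (W := delV v ((F ∩ G).filter fun S => S ∈ (bySize (· < 3) : Finset (Finset α))))
      (fun b hb => card_le_two_of_mem_delV_filter hb) hv h2 hcard
    rw [hdbl] at b1 b2
    have memB : ∀ {y : α}, v ≠ y →
        (({y} : Finset α) ∈ linkV v ((F ∩ G).filter fun S => S ∈ (bySize (· < 3) : Finset (Finset α)))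
          ↔ ({v, y} : Finset α) ∈ F ∧ ({v, y} : Finset α) ∈ G) :=
      fun hvy => by rw [mem_linkV_filter_bySize_iff (by simpa using hvy) (by simp), mem_inter]
    have memA : ∀ {x y : α}, x ≠ y → v ≠ x → v ≠ y →
        (({x, y} : Finset α) ∈ delV v ((F ∩ G).filter fun S => S ∈ (bySize (· < 3) : Finset (Finset α)))
          ↔ ({x, y} : Finset α) ∈ F ∧ ({x, y} : Finset α) ∈ G) :=
      fun hxy hvx hvy => by rw [mem_delV_filter_bySize_iff (by simp [hvx, hvy]) (by rw [card_pair hxy]), mem_inter]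
    rw [card_filter_three h12 h13 h23] at b1
    simp only [memB hv1, memB hv2, memB hv3] at b1
    rw [card_filter_three h12 h13 h23, er1, er2, er3] at b2
    simp only [memA h23 hv2 hv3, memA h13 hv1 hv3, memA h12 hv1 hv2] at b2
    linarith
  linarith

end RowThree

end Summit.CriticalPhenomena.PercolationContinuityZ3.Theorems.SahiCTCForms
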